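import Mathlib
import HarnessLib
import Summits.QuantumFields.Statement
import Summits.QuantumFields.YangMills.Theses.UnitScaleTilt
import Summits.QuantumFields.YangMills.Theses.FibreConvexityTail
import Summits.QuantumFields.YangMills.Theorems.FibreConvexityTailHistoryTailOfTwoSided
import Literature.MathematicalPhysics.QuantumFieldTheory.Balaban1983to89.T3YM3TorusStatement
import Summits.QuantumFields.YangMills.Theses.PoincareLipschitz

/-!
# LINE poincare_lipschitz — skeleton (crux stmt-QuantumFields-19936 `UnitScaleTilt.HistoryTailL`)

Seat ym-r3-idea-2 g7, lens «nearmiss». Route route-QuantumFields-PoincareLipschitz (`Summits.QuantumFields.YangMills.Theses.PoincareLipschitz`, imported).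
Stubs: `stub_boundedBoxConcentration` (first rung of K1: boxes n ≤ 17·L³), `stub_mesoscopicBoxConcentration`
(K1 for 17·L³ < n ≤ β_K, organ-adjacent, HARDEST), `stub_levelOneLipschitz` (K2 at j = 1, one averaging step),
`stub_iteratedLipschitz` (K2 for j ≥ 2).  Compositions `MesoscopicConcentrationL_of`, `BlockLipschitzL_of`,
`HistoryTailL_of` are kernel-checked (no sorry).  No summit and no rung is proved here.
-/



namespace Summit.QuantumFields.YangMills.Cruxes.HistoryTailL.PoincareLipschitz

open scoped BigOperators Topology Classical MeasureTheory
open MeasureTheory Summit.QuantumFields.YangMills.Theses.PoincareLipschitz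

/-- STUB (first rung of the deciding crux): mesoscopic concentration for BOUNDED boxes `n ≤ 17·L³`. -/
theorem stub_boundedBoxConcentration :
    open Literature.MathematicalPhysics.QuantumFieldTheory.Balaban1983to89 Literature.MathematicalPhysics.QuantumFieldTheory.Balaban1983to89.T3ContinuumYM3Torus in ∀ (L : ℕ), ∃ (Cc cc : ℝ), 0 ≤ Cc ∧ 0 < cc ∧ ∃ γ₁ : ℝ, 0 < γ₁ ∧ γ₁ ≤ 1 ∧ ∀ (F : T3Family) (γ : ℝ), F.L = L → 0 < γ → γ ≤ γ₁ → ∀ (K n : ℕ), 1 ≤ n → (n : ℝ) ≤ (F.scheme T3UnitLawDensityEML.ℰp γ).β K → 2 * n ≤ (F.P K).sitesPerDir 0 → n ≤ 17 * L ^ 3 → ∀ (x₀ : Site (F.P K) 0) (f : GaugeField (F.P K) 0 (Matrix.specialUnitaryGroup (Fin 2) ℂ) → ℝ) (Λ : ℝ), 0 < Λ → Measurable f → GaugeField.GaugeInvariant f → (∀ U U' : GaugeField (F.P K) 0 (Matrix.specialUnitaryGroup (Fin 2) ℂ), (∀ b : PBond (F.P K) 0, (∀ k, (b.src k - x₀ k).val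 < n) → (∀ k, (b.tgt k - x₀ k).val < n) → U b = U' b) → f U = f U') → (∀ U U' : GaugeField (F.P K) 0 (Matrix.specialUnitaryGroup (Fin 2) ℂ), |f U - f U'| ≤ Λ * Real.sqrt (∑ b : PBond (F.P K) 0, GaugeGroup.dist1 (U b * (U' b)⁻¹) ^ 2)) → ∀ r : ℝ, 0 ≤ r → (T3UnitScaleTilt.gibbsK F T3UnitLawDensityEML.ℰp γ K).real {U | r ≤ f U - ∫ V, f V ∂(T3UnitScaleTilt.gibbsK F T3UnitLawDensityEML.ℰp γ K)} ≤ Cc * Real.exp (-(cc * (F.scheme T3UnitLawDensityEML.ℰp γ).β K * r ^ 2 / ((n : ℝ) ^ 2 * Λ ^ 2))) := by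
  sorry

/-- STUB (HARDEST, organ-adjacent): mesoscopic concentration for boxes `17·L³ < n ≤ β_K`. -/
theorem stub_mesoscopicBoxConcentration :
    open Literature.MathematicalPhysics.QuantumFieldTheory.Balaban1983to89 Literature.MathematicalPhysics.QuantumFieldTheory.Balaban1983to89.T3ContinuumYM3Torus in ∀ (L : ℕ), ∃ (Cc cc : ℝ), 0 ≤ Cc ∧ 0 < cc ∧ ∃ γ₁ : ℝ, 0 < γ₁ ∧ γ₁ ≤ 1 ∧ ∀ (F : T3Family) (γ : ℝ), F.L = L → 0 < γ → γ ≤ γ₁ → ∀ (K n : ℕ), 1 ≤ n → (n : ℝ) ≤ (F.scheme T3UnitLawDensityEML.ℰp γ).β K → 2 * n ≤ (F.P K).sitesPerDir 0 → 17 * L ^ 3 < n → ∀ (x₀ : Site (F.P K) 0) (f : GaugeField (F.P K) 0 (Matrix.specialUnitaryGroup (Fin 2) ℂ) → ℝ) (Λ : ℝ), 0 < Λ → Measurable f → GaugeField.GaugeInvariant f → (∀ U U' : GaugeField (F.P K) 0 (Matrix.specialUnitaryGroup (Fin 2) ℂ), (∀ b : PBond (F.P K) 0, (∀ k, (b.src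 k - x₀ k).val < n) → (∀ k, (b.tgt k - x₀ k).val < n) → U b = U' b) → f U = f U') → (∀ U U' : GaugeField (F.P K) 0 (Matrix.specialUnitaryGroup (Fin 2) ℂ), |f U - f U'| ≤ Λ * Real.sqrt (∑ b : PBond (F.P K) 0, GaugeGroup.dist1 (U b * (U' b)⁻¹) ^ 2)) → ∀ r : ℝ, 0 ≤ r → (T3UnitScaleTilt.gibbsK F T3UnitLawDensityEML.ℰp γ K).real {U | r ≤ f U - ∫ V, f V ∂(T3UnitScaleTilt.gibbsK F T3UnitLawDensityEML.ℰp γ K)} ≤ Cc * Real.exp (-(cc * (F.scheme T3UnitLawDensityEML.ℰp γ).β K * r ^ 2 / ((n : ℝ) ^ 2 * Λ ^ 2))) := by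
  sorry

/-- STUB (first rung of K2): the level-one (`j = 1`) link-Lipschitz bound — one Bałaban averaging step (Schur bound √L). -/
theorem stub_levelOneLipschitz :
    open Literature.MathematicalPhysics.QuantumFieldTheory.Balaban1983to89 Literature.MathematicalPhysics.QuantumFieldTheory.Balaban1983to89.T3ContinuumYM3Torus in ∀ (L : ℕ), ∃ CL : ℝ, 0 ≤ CL ∧ ∀ (b₀ p₀ : ℝ), 0 < b₀ → 2 < p₀ → ∃ γ₁ : ℝ, 0 < γ₁ ∧ γ₁ ≤ 1 ∧ ∀ (F : T3Family) (γ : ℝ), F.L = L → 0 < γ → γ ≤ γ₁ → ∀ (K j : ℕ), 1 ≤ j → j + 2 ≤ K → j ≤ 1 → ∀ (a : Plaq (F.P K) j) (U U' : GaugeField (F.P K) 0 (Matrix.specialUnitaryGroup (Fin 2) ℂ)), (∀ (i : ℕ) (q : Plaq (F.P K) i), i < j → Site.tdist (fun k => ((((q.src k).val * F.L ^ i : ℕ)) : ZMod ((F.P K).sitesPerDir 0))) (fun k => ((((a.src k).val * F.L ^ j : ℕ)) : ZMod ((F.P K).sitesPerDir 0))) + 64 * F.L ^ i ≤ 64 *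 F.L ^ j → GaugeGroup.dist1 (GaugeField.plaqHol (Averaging.iter (fun i' => BlockAveraging.blockAvg (P := F.P K) (j := i') T3UnitLawDensityEML.ℰp) i U) q) < T3UnitScaleTilt.θBal F.L γ b₀ p₀ (K - i)) → (∀ (i : ℕ) (q : Plaq (F.P K) i), i < j → Site.tdist (fun k => ((((q.src k).val * F.L ^ i : ℕ)) : ZMod ((F.P K).sitesPerDir 0))) (fun k => ((((a.src k).val * F.L ^ j : ℕ)) : ZMod ((F.P K).sitesPerDir 0))) + 64 * F.L ^ i ≤ 64 * F.L ^ j → GaugeGroup.dist1 (GaugeField.plaqHol (Averaging.iter (fun i' => BlockAveraging.blockAvg (P := F.P K) (j := i') T3UnitLawDensityEML.ℰp) i U') q) < T3UnitScaleTilt.θBal F.L γ b₀ p₀ (K - i)) → |GaugeGroup.dist1 (GaugeField.plaqHol (Averaging.iter (fun i' => BlockAveraging.blockAvg (P := F.P K) (j := i') T3UnitLawDensityEML.ℰp) j U) a) - GaugeGroup.dist1 (GaugeField.plaqHol (Averaging.iter (fun i' => BlockAveraging.blockAvg (P := F.P K) (j := i') T3UnitLawDensityEML.ℰp) j U') a)|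 ≤ CL / Real.sqrt ((F.L : ℝ) ^ j) * Real.sqrt (∑ b : PBond (F.P K) 0, if (∀ k, (b.src k - ((((a.src k).val * F.L ^ j : ℕ)) : ZMod ((F.P K).sitesPerDir 0)) + ((8 * F.L ^ j : ℕ) : ZMod ((F.P K).sitesPerDir 0))).val < 17 * F.L ^ j) ∧ (∀ k, (b.tgt k - ((((a.src k).val * F.L ^ j : ℕ)) : ZMod ((F.P K).sitesPerDir 0)) + ((8 * F.L ^ j : ℕ) : ZMod ((F.P K).sitesPerDir 0))).val < 17 * F.L ^ j) then GaugeGroup.dist1 (U b * (U' b)⁻¹) ^ 2 else 0) := by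
  sorry

/-- STUB: the iterated (`j ≥ 2`) link-Lipschitz bound along the locally good tower. -/
theorem stub_iteratedLipschitz :
    open Literature.MathematicalPhysics.QuantumFieldTheory.Balaban1983to89 Literature.MathematicalPhysics.QuantumFieldTheory.Balaban1983to89.T3ContinuumYM3Torus in ∀ (L : ℕ), ∃ CL : ℝ, 0 ≤ CL ∧ ∀ (b₀ p₀ : ℝ), 0 < b₀ → 2 < p₀ → ∃ γ₁ : ℝ, 0 < γ₁ ∧ γ₁ ≤ 1 ∧ ∀ (F : T3Family) (γ : ℝ), F.L = L → 0 < γ → γ ≤ γ₁ → ∀ (K j : ℕ), 1 ≤ j → j + 2 ≤ K → 2 ≤ j → ∀ (a : Plaq (F.P K) j) (U U' : GaugeField (F.P K) 0 (Matrix.specialUnitaryGroup (Fin 2) ℂ)), (∀ (i : ℕ) (q : Plaq (F.P K) i), i < j → Site.tdist (fun k => ((((q.src k).val * F.L ^ i : ℕ)) : ZMod ((F.P K).sitesPerDir 0))) (fun k => ((((a.src k).val * F.L ^ j : ℕ)) : ZMod ((F.P K).sitesPerDir 0))) + 64 * F.L ^ i ≤ 64 * F.L ^ j → GaugeGroup.dist1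 (GaugeField.plaqHol (Averaging.iter (fun i' => BlockAveraging.blockAvg (P := F.P K) (j := i') T3UnitLawDensityEML.ℰp) i U) q) < T3UnitScaleTilt.θBal F.L γ b₀ p₀ (K - i)) → (∀ (i : ℕ) (q : Plaq (F.P K) i), i < j → Site.tdist (fun k => ((((q.src k).val * F.L ^ i : ℕ)) : ZMod ((F.P K).sitesPerDir 0))) (fun k => ((((a.src k).val * F.L ^ j : ℕ)) : ZMod ((F.P K).sitesPerDir 0))) + 64 * F.L ^ i ≤ 64 * F.L ^ j → GaugeGroup.dist1 (GaugeField.plaqHol (Averaging.iter (fun i' => BlockAveraging.blockAvg (P := F.P K) (j := i') T3UnitLawDensityEML.ℰp) i U') q) < T3UnitScaleTilt.θBal F.L γ b₀ p₀ (K - i)) → |GaugeGroup.dist1 (GaugeField.plaqHol (Averaging.iter (fun i' => BlockAveraging.blockAvg (P := F.P K) (j := i') T3UnitLawDensityEML.ℰp) j U) a) - GaugeGroup.dist1 (GaugeField.plaqHol (Averaging.iter (fun i' => BlockAveraging.blockAvg (P := F.P K) (j := i') T3UnitLawDensityEML.ℰp) j U') a)| ≤ CL / Real.sqrt ((F.L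 : ℝ) ^ j) * Real.sqrt (∑ b : PBond (F.P K) 0, if (∀ k, (b.src k - ((((a.src k).val * F.L ^ j : ℕ)) : ZMod ((F.P K).sitesPerDir 0)) + ((8 * F.L ^ j : ℕ) : ZMod ((F.P K).sitesPerDir 0))).val < 17 * F.L ^ j) ∧ (∀ k, (b.tgt k - ((((a.src k).val * F.L ^ j : ℕ)) : ZMod ((F.P K).sitesPerDir 0)) + ((8 * F.L ^ j : ℕ) : ZMod ((F.P K).sitesPerDir 0))).val < 17 * F.L ^ j) then GaugeGroup.dist1 (U b * (U' b)⁻¹) ^ 2 else 0) := by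
  sorry

/-- Monotonicity of the Gaussian tail profile in its two constants. -/
theorem profile_mono {C C' c c' X : ℝ} (hC0 : 0 ≤ C) (hC : C ≤ C') (hc : c' ≤ c) (hX : 0 ≤ X) :
    C * Real.exp (-(c * X)) ≤ C' * Real.exp (-(c' * X)) := by
  apply mul_le_mul hC _ (Real.exp_pos _).le (hC0.trans hC)
  exact Real.exp_le_exp.mpr (by nlinarith)

/-- COMPOSITION (kernel-checked): the two box-size ranges give the deciding crux `MesoscopicConcentrationL`. -/
theorem MesoscopicConcentrationL_of
    (hA : open Literature.MathematicalPhysics.QuantumFieldTheory.Balaban1983to89 Literature.MathematicalPhysics.QuantumFieldTheory.Balaban1983to89.T3ContinuumYM3Torus in ∀ (L : ℕ), ∃ (Cc cc : ℝ), 0 ≤ Cc ∧ 0 < cc ∧ ∃ γ₁ : ℝ, 0 < γ₁ ∧ γ₁ ≤ 1 ∧ ∀ (F : T3Family) (γ : ℝ), F.L = L → 0 < γ → γ ≤ γ₁ → ∀ (K n : ℕ), 1 ≤ n → (n : ℝ) ≤ (F.scheme T3UnitLawDensityEML.ℰp γ).β K → 2 * n ≤ (F.P K).sitesPerDir 0 →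 n ≤ 17 * L ^ 3 → ∀ (x₀ : Site (F.P K) 0) (f : GaugeField (F.P K) 0 (Matrix.specialUnitaryGroup (Fin 2) ℂ) → ℝ) (Λ : ℝ), 0 < Λ → Measurable f → GaugeField.GaugeInvariant f → (∀ U U' : GaugeField (F.P K) 0 (Matrix.specialUnitaryGroup (Fin 2) ℂ), (∀ b : PBond (F.P K) 0, (∀ k, (b.src k - x₀ k).val < n) → (∀ k, (b.tgt k - x₀ k).val < n) → U b = U' b) → f U = f U') → (∀ U U' : GaugeField (F.P K) 0 (Matrix.specialUnitaryGroup (Fin 2) ℂ), |f U - f U'| ≤ Λ * Real.sqrt (∑ b : PBond (F.P K) 0, GaugeGroup.dist1 (U b * (U' b)⁻¹) ^ 2)) → ∀ r : ℝ, 0 ≤ r → (T3UnitScaleTilt.gibbsK F T3UnitLawDensityEML.ℰp γ K).real {U | r ≤ f U - ∫ V, f V ∂(T3UnitScaleTilt.gibbsK F T3UnitLawDensityEML.ℰp γ K)} ≤ Cc * Real.exp (-(cc * (F.scheme T3UnitLawDensityEML.ℰp γ).β K * r ^ 2 / ((n : ℝ) ^ 2 * Λ ^ 2))))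
    (hB : open Literature.MathematicalPhysics.QuantumFieldTheory.Balaban1983to89 Literature.MathematicalPhysics.QuantumFieldTheory.Balaban1983to89.T3ContinuumYM3Torus in ∀ (L : ℕ), ∃ (Cc cc : ℝ), 0 ≤ Cc ∧ 0 < cc ∧ ∃ γ₁ : ℝ, 0 < γ₁ ∧ γ₁ ≤ 1 ∧ ∀ (F : T3Family) (γ : ℝ), F.L = L → 0 < γ → γ ≤ γ₁ → ∀ (K n : ℕ), 1 ≤ n → (n : ℝ) ≤ (F.scheme T3UnitLawDensityEML.ℰp γ).β K → 2 * n ≤ (F.P K).sitesPerDir 0 → 17 * L ^ 3 < n → ∀ (x₀ : Site (F.P K) 0) (f : GaugeField (F.P K) 0 (Matrix.specialUnitaryGroup (Fin 2) ℂ) → ℝ) (Λ : ℝ), 0 < Λ → Measurable f → GaugeField.GaugeInvariant f → (∀ U U' : GaugeField (F.P K) 0 (Matrix.specialUnitaryGroup (Fin 2) ℂ), (∀ b : PBond (F.P K) 0, (∀ k, (b.src k - x₀ k).val < n) → (∀ k, (b.tgt k - x₀ k).val < n) → U b = U' b) → f U = f U') → (∀ U U' : GaugeField (F.P K) 0 (Matrix.specialUnitaryGroup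 (Fin 2) ℂ), |f U - f U'| ≤ Λ * Real.sqrt (∑ b : PBond (F.P K) 0, GaugeGroup.dist1 (U b * (U' b)⁻¹) ^ 2)) → ∀ r : ℝ, 0 ≤ r → (T3UnitScaleTilt.gibbsK F T3UnitLawDensityEML.ℰp γ K).real {U | r ≤ f U - ∫ V, f V ∂(T3UnitScaleTilt.gibbsK F T3UnitLawDensityEML.ℰp γ K)} ≤ Cc * Real.exp (-(cc * (F.scheme T3UnitLawDensityEML.ℰp γ).β K * r ^ 2 / ((n : ℝ) ^ 2 * Λ ^ 2)))) :
    MesoscopicConcentrationL := by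
  intro L
  obtain ⟨C1, c1, hC1, hc1, γa, hγa, hγa1, HA⟩ := hA L
  obtain ⟨C2, c2, hC2, hc2, γb, hγb, hγb1, HB⟩ := hB L
  refine ⟨max C1 C2, min c1 c2, le_max_of_le_left hC1, lt_min hc1 hc2, min γa γb, lt_min hγa hγb,
    (min_le_left _ _).trans hγa1, ?_⟩
  intro F γ hFL hγ hγ1 K n hn hnβ hn2 x₀ f Λ hΛ hf hgi hloc hlip r hr
  have hβ : 0 ≤ (F.scheme Literature.MathematicalPhysics.QuantumFieldTheory.Balaban1983to89.T3UnitLawDensityEML.ℰp γ).β K :=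
    F.scheme_β_nonneg _ hγ.le K
  have hX : 0 ≤ (F.scheme Literature.MathematicalPhysics.QuantumFieldTheory.Balaban1983to89.T3UnitLawDensityEML.ℰp γ).β K * r ^ 2 / (((n : ℕ) : ℝ) ^ 2 * Λ ^ 2) :=
    div_nonneg (mul_nonneg hβ (sq_nonneg r)) (mul_nonneg (sq_nonneg _) (sq_nonneg _))
  have e1 : ∀ c : ℝ, c * (F.scheme Literature.MathematicalPhysics.QuantumFieldTheory.Balaban1983to89.T3UnitLawDensityEML.ℰp γ).β K * r ^ 2 / (((n : ℕ) : ℝ) ^ 2 * Λ ^ 2)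
      = c * ((F.scheme Literature.MathematicalPhysics.QuantumFieldTheory.Balaban1983to89.T3UnitLawDensityEML.ℰp γ).β K * r ^ 2 / (((n : ℕ) : ℝ) ^ 2 * Λ ^ 2)) :=
    fun c => by ring
  by_cases hcase : n ≤ 17 * L ^ 3
  · have h := HA F γ hFL hγ (hγ1.trans (min_le_left γa γb)) K n hn hnβ hn2 hcase x₀ f Λ hΛ hf hgi hloc hlip r hr
    rw [e1 c1] at h
    rw [e1 (min c1 c2)]
    exact h.trans (profile_mono hC1 (le_max_left _ _) (min_le_left _ _) hX)
  · have h := HB F γ hFL hγ (hγ1.trans (min_le_right γa γb)) K n hn hnβ hn2 (lt_of_not_ge hcase) x₀ f Λ hΛ hf hgi hloc hlip r hr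
    rw [e1 c2] at h
    rw [e1 (min c1 c2)]
    exact h.trans (profile_mono hC2 (le_max_right _ _) (min_le_right _ _) hX)

/-- COMPOSITION (kernel-checked): the two depth ranges give `BlockLipschitzL`. -/
theorem BlockLipschitzL_of
    (hA : open Literature.MathematicalPhysics.QuantumFieldTheory.Balaban1983to89 Literature.MathematicalPhysics.QuantumFieldTheory.Balaban1983to89.T3ContinuumYM3Torus in ∀ (L : ℕ), ∃ CL : ℝ, 0 ≤ CL ∧ ∀ (b₀ p₀ : ℝ), 0 < b₀ → 2 < p₀ → ∃ γ₁ : ℝ, 0 < γ₁ ∧ γ₁ ≤ 1 ∧ ∀ (F : T3Family) (γ : ℝ), F.L = L → 0 < γ → γ ≤ γ₁ → ∀ (K j : ℕ), 1 ≤ j → j + 2 ≤ K → j ≤ 1 → ∀ (a : Plaq (F.P K) j) (U U' : GaugeField (F.P K) 0 (Matrix.specialUnitaryGroup (Fin 2) ℂ)), (∀ (i : ℕ) (q : Plaq (F.P K) i), i < j → Site.tdist (fun k => ((((q.src k).val * F.L ^ i : ℕ)) : ZMod ((F.P K).sitesPerDir 0))) (fun k => ((((a.src k).val * F.L ^ j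 : ℕ)) : ZMod ((F.P K).sitesPerDir 0))) + 64 * F.L ^ i ≤ 64 * F.L ^ j → GaugeGroup.dist1 (GaugeField.plaqHol (Averaging.iter (fun i' => BlockAveraging.blockAvg (P := F.P K) (j := i') T3UnitLawDensityEML.ℰp) i U) q) < T3UnitScaleTilt.θBal F.L γ b₀ p₀ (K - i)) → (∀ (i : ℕ) (q : Plaq (F.P K) i), i < j → Site.tdist (fun k => ((((q.src k).val * F.L ^ i : ℕ)) : ZMod ((F.P K).sitesPerDir 0))) (fun k => ((((a.src k).val * F.L ^ j : ℕ)) : ZMod ((F.P K).sitesPerDir 0))) + 64 * F.L ^ i ≤ 64 * F.L ^ j → GaugeGroup.dist1 (GaugeField.plaqHol (Averaging.iter (fun i' => BlockAveraging.blockAvg (P := F.P K) (j := i') T3UnitLawDensityEML.ℰp) i U') q) < T3UnitScaleTilt.θBal F.L γ b₀ p₀ (K - i)) → |GaugeGroup.dist1 (GaugeField.plaqHol (Averaging.iter (fun i' => BlockAveraging.blockAvg (P := F.P K) (j := i') T3UnitLawDensityEML.ℰp) j U) a) - GaugeGroup.dist1 (GaugeField.plaqHol (Averaging.iter (fun i'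 => BlockAveraging.blockAvg (P := F.P K) (j := i') T3UnitLawDensityEML.ℰp) j U') a)| ≤ CL / Real.sqrt ((F.L : ℝ) ^ j) * Real.sqrt (∑ b : PBond (F.P K) 0, if (∀ k, (b.src k - ((((a.src k).val * F.L ^ j : ℕ)) : ZMod ((F.P K).sitesPerDir 0)) + ((8 * F.L ^ j : ℕ) : ZMod ((F.P K).sitesPerDir 0))).val < 17 * F.L ^ j) ∧ (∀ k, (b.tgt k - ((((a.src k).val * F.L ^ j : ℕ)) : ZMod ((F.P K).sitesPerDir 0)) + ((8 * F.L ^ j : ℕ) : ZMod ((F.P K).sitesPerDir 0))).val < 17 * F.L ^ j) then GaugeGroup.dist1 (U b * (U' b)⁻¹) ^ 2 else 0))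
    (hB : open Literature.MathematicalPhysics.QuantumFieldTheory.Balaban1983to89 Literature.MathematicalPhysics.QuantumFieldTheory.Balaban1983to89.T3ContinuumYM3Torus in ∀ (L : ℕ), ∃ CL : ℝ, 0 ≤ CL ∧ ∀ (b₀ p₀ : ℝ), 0 < b₀ → 2 < p₀ → ∃ γ₁ : ℝ, 0 < γ₁ ∧ γ₁ ≤ 1 ∧ ∀ (F : T3Family) (γ : ℝ), F.L = L → 0 < γ → γ ≤ γ₁ → ∀ (K j : ℕ), 1 ≤ j → j + 2 ≤ K → 2 ≤ j → ∀ (a : Plaq (F.P K) j) (U U' : GaugeField (F.P K) 0 (Matrix.specialUnitaryGroup (Fin 2) ℂ)), (∀ (i : ℕ) (q : Plaq (F.P K) i), i < j → Site.tdist (fun k => ((((q.src k).val * F.L ^ i : ℕ)) : ZMod ((F.P K).sitesPerDir 0))) (fun k => ((((a.src k).val * F.L ^ j : ℕ)) : ZMod ((F.P K).sitesPerDir 0))) + 64 * F.L ^ i ≤ 64 * F.L ^ j → GaugeGroup.dist1 (GaugeField.plaqHol (Averaging.iter (fun i' => BlockAveraging.blockAvg (P := F.P K) (j := i') T3UnitLawDensityEML.ℰp)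 i U) q) < T3UnitScaleTilt.θBal F.L γ b₀ p₀ (K - i)) → (∀ (i : ℕ) (q : Plaq (F.P K) i), i < j → Site.tdist (fun k => ((((q.src k).val * F.L ^ i : ℕ)) : ZMod ((F.P K).sitesPerDir 0))) (fun k => ((((a.src k).val * F.L ^ j : ℕ)) : ZMod ((F.P K).sitesPerDir 0))) + 64 * F.L ^ i ≤ 64 * F.L ^ j → GaugeGroup.dist1 (GaugeField.plaqHol (Averaging.iter (fun i' => BlockAveraging.blockAvg (P := F.P K) (j := i') T3UnitLawDensityEML.ℰp) i U') q) < T3UnitScaleTilt.θBal F.L γ b₀ p₀ (K - i)) → |GaugeGroup.dist1 (GaugeField.plaqHol (Averaging.iter (fun i' => BlockAveraging.blockAvg (P := F.P K) (j := i') T3UnitLawDensityEML.ℰp) j U) a) - GaugeGroup.dist1 (GaugeField.plaqHol (Averaging.iter (fun i' => BlockAveraging.blockAvg (P := F.P K) (j := i') T3UnitLawDensityEML.ℰp) j U') a)| ≤ CL / Real.sqrt ((F.L : ℝ) ^ j) * Real.sqrt (∑ b : PBond (F.P K) 0, if (∀ k, (b.src k - ((((a.src k).val * F.L ^ j : ℕ))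 : ZMod ((F.P K).sitesPerDir 0)) + ((8 * F.L ^ j : ℕ) : ZMod ((F.P K).sitesPerDir 0))).val < 17 * F.L ^ j) ∧ (∀ k, (b.tgt k - ((((a.src k).val * F.L ^ j : ℕ)) : ZMod ((F.P K).sitesPerDir 0)) + ((8 * F.L ^ j : ℕ) : ZMod ((F.P K).sitesPerDir 0))).val < 17 * F.L ^ j) then GaugeGroup.dist1 (U b * (U' b)⁻¹) ^ 2 else 0)) :
    BlockLipschitzL := by
  intro L
  obtain ⟨C1, hC1, HA⟩ := hA L
  obtain ⟨C2, hC2, HB⟩ := hB L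
  refine ⟨max C1 C2, le_max_of_le_left hC1, ?_⟩
  intro b₀ p₀ hb hp
  obtain ⟨γa, hγa, hγa1, HA'⟩ := HA b₀ p₀ hb hp
  obtain ⟨γb, hγb, hγb1, HB'⟩ := HB b₀ p₀ hb hp
  refine ⟨min γa γb, lt_min hγa hγb, (min_le_left _ _).trans hγa1, ?_⟩
  intro F γ hFL hγ hγ1 K j hj hjK a U U' hU hU'
  by_cases hcase : j ≤ 1
  · have h := HA' F γ hFL hγ (hγ1.trans (min_le_left γa γb)) K j hj hjK hcase a U U' hU hU'
    refine h.trans (mul_le_mul_of_nonneg_right ?_ (Real.sqrt_nonneg _))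
    exact div_le_div_of_nonneg_right (le_max_left _ _) (Real.sqrt_nonneg _)
  · have h := HB' F γ hFL hγ (hγ1.trans (min_le_right γa γb)) K j hj hjK (by omega) a U U' hU hU'
    refine h.trans (mul_le_mul_of_nonneg_right ?_ (Real.sqrt_nonneg _))
    exact div_le_div_of_nonneg_right (le_max_right _ _) (Real.sqrt_nonneg _)

/-- COMPOSITION (kernel-checked): the four stubs, the provable-now locality support, the shared first-moment
crux and the route glue give the crux `UnitScaleTilt.HistoryTailL` BY NAME (through the landed
`fibreConvexityTail_historyTailOfTwoSided_proof`). -/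
theorem HistoryTailL_of
    (hLoc : Summit.QuantumFields.YangMills.Theses.PoincareLipschitz.BlockLocalityL)
    (hM : Summit.QuantumFields.YangMills.Theses.PoincareLipschitz.MeanDeviationL)
    (hG : Summit.QuantumFields.YangMills.Theses.PoincareLipschitz.TwoSidedOfConcentration) :
    Summit.QuantumFields.YangMills.Theses.UnitScaleTilt.HistoryTailL :=
  Summit.QuantumFields.YangMills.Theorems.fibreConvexityTail_historyTailOfTwoSided_proof
    (hG (MesoscopicConcentrationL_of stub_boundedBoxConcentration stub_mesoscopicBoxConcentration)
      (BlockLipschitzL_of stub_levelOneLipschitz stub_iteratedLipschitz) hLoc hM).1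
    (hG (MesoscopicConcentrationL_of stub_boundedBoxConcentration stub_mesoscopicBoxConcentration)
      (BlockLipschitzL_of stub_levelOneLipschitz stub_iteratedLipschitz) hLoc hM).2

end Summit.QuantumFields.YangMills.Cruxes.HistoryTailL.PoincareLipschitz
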